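import Mathlib
import Summits.Ventures.PercRepro.PuncturedLYMFibrationNode

/-!
# PercRepro — THE FIBRATION OVER A MEMBER OF A MULTI-MEMBER NODE: THE FIRST FAMILY OF LAYER INEQUALITIES
(p10, gen 38)

At a node of the fibration recursion fibrated over a member `C` of size `m` (PuncturedLYMFibrationNode: other members'
rows `r t` and member columns `q t` per level, excesses `en a = ρ·Rn a − Qn a − θ·Un a`, partial sums `Hn a`), the FIRST
family of constraints `0 ≤ Hn a` (the horizontal weights are nonnegative) needs no adjacent-row condition: it follows
from the fibre-0 density condition `0 ≤ en 0` and the totals `Hn m = NC ≥ 0` alone, as soon as the set of layers with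
nonnegative excess is an INTERVAL (`first_family_of_interval`, by `sum_range_ge_min_zero`).  That interval property is
a θ-free statement: `en b ≥ 0 ⟺ ψ b ≥ θ` with `ψ b = (ρ·r (ℓ−b) − q (ℓ−b)) / r (ℓ−b+1)` (`en_nonneg_iff_psi`), so it
holds whenever `ψ` is quasi-concave along the layers (`interval_of_quasiconcave`), which in turn follows from the
convexity of the chain `t ↦ (r t / r (t+1), q t / r (t+1))` — its slopes monotone in the level (`steps_of_slopes`,
`quasiconcave_of_steps`).  `first_family` assembles the chain.  Here `r`, `q` are arbitrary sequences (every layer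
nonempty); that the chain of a pairwise disjoint family IS convex is not asserted here (the data of gen 38: every size
multiset on ≤ 12 points).
-/

namespace PercRepro.PuncturedLYM.Split.NodeArith

open Finset OneArith

section

variable {m ℓ : ℕ} {ρ θ : ℚ} {r q : ℕ → ℚ} {NC : ℚ}

/-- **THE FIRST FAMILY FROM THE INTERVAL PROPERTY.** If the layers with nonnegative excess form an interval, the
excess of layer `0` is nonnegative and the totals `Hn m = NC` are nonnegative, then every partial sum `Hn a`, `a ≤ m`,
is nonnegative. -/
theorem first_family_of_interval
    (hint : ∀ b b' b'', b ≤ b' → b' ≤ b'' → b'' < m → 0 ≤ en m ℓ ρ θ r q b → 0 ≤ en m ℓ ρ θ r q b'' →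
      0 ≤ en m ℓ ρ θ r q b')
    (h0 : 0 ≤ en m ℓ ρ θ r q 0) (htot : Hn m ℓ ρ θ r q m = NC) (hNC : 0 ≤ NC) :
    ∀ a, a ≤ m → 0 ≤ Hn m ℓ ρ θ r q a := by
  intro a ha
  have hdown : ∀ b b', b ≤ b' → b' < m → 0 ≤ en m ℓ ρ θ r q b' → 0 ≤ en m ℓ ρ θ r q b := by
    intro b b' hbb' hb' hb'pos
    exact hint 0 b b' (Nat.zero_le b) hbb' hb' h0 hb'pos
  have hmin := sum_range_ge_min_zero (en m ℓ ρ θ r q) m hdown a ha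
  unfold Hn at htot ⊢
  rw [htot, min_eq_left hNC] at hmin
  exact hmin

/-- The θ-free layer quotient `ψ b = (ρ·r (ℓ−b) − q (ℓ−b)) / r (ℓ−b+1)`: the excess of layer `b` is nonnegative iff
`ψ b ≥ θ`. -/
def psi (ℓ : ℕ) (ρ : ℚ) (r q : ℕ → ℚ) (b : ℕ) : ℚ := (ρ * r (ℓ - b) - q (ℓ - b)) / r (ℓ - b + 1)

/-- `0 ≤ en b ⟺ θ ≤ ψ b` for a layer `b ≤ m` whose fibre has free columns (`0 < r (ℓ − b + 1)`). -/
theorem en_nonneg_iff_psi (b : ℕ) (hb : b ≤ m) (hr : 0 < r (ℓ - b + 1)) :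
    0 ≤ en m ℓ ρ θ r q b ↔ θ ≤ psi ℓ ρ r q b := by
  have hc : (0 : ℚ) < (m.choose b : ℚ) := by exact_mod_cast Nat.choose_pos hb
  unfold en psi Rn Un Qn
  rw [le_div_iff₀ hr]
  constructor
  · intro h
    have h' : 0 ≤ (m.choose b : ℚ) * (ρ * r (ℓ - b) - q (ℓ - b) - θ * r (ℓ - b + 1)) := by linarith
    have := nonneg_of_mul_nonneg_right h' hc
    linarith
  · intro h
    have h' : 0 ≤ ρ * r (ℓ - b) - q (ℓ - b) - θ * r (ℓ - b + 1) := by linarith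
    have := mul_nonneg hc.le h'
    linarith

/-- Quasi-concavity of a sequence from the downward closure of its upward steps: if every upward step `f c ≤ f (c+1)`
below an upward step is itself upward (`f` rises then falls), then `min (f b) (f b'') ≤ f b'` for `b ≤ b' ≤ b'' < K`. -/
theorem quasiconcave_of_steps (f : ℕ → ℚ) (K : ℕ)
    (hstep : ∀ c c', c ≤ c' → c' + 1 < K → f c' ≤ f (c' + 1) → f c ≤ f (c + 1))
    (b b' b'' : ℕ) (hbb' : b ≤ b') (hb'b'' : b' ≤ b'') (hb'' : b'' < K) :
    min (f b) (f b'') ≤ f b' := by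
  rcases Nat.eq_zero_or_pos b' with hb'0 | hb'pos
  · subst hb'0
    have : b = 0 := by omega
    subst this
    exact min_le_left _ _
  rcases le_or_gt (f (b' - 1)) (f b') with hup | hdown
  · -- the step into `b'` is upward, hence so is every step below it: `f` is monotone on `[0, b']`
    have hmono : ∀ d, d ≤ b' → f (b' - d) ≤ f b' := by
      intro d
      induction d with
      | zero => intro _; simp
      | succ d ih =>
        intro hd
        have h1 : f (b' - (d + 1)) ≤ f (b' - (d + 1) + 1) := by
          have hc' : b' - 1 + 1 < K := by omega
          have hstep' := hstep (b' - (d + 1)) (b' - 1) (by omega) hc' (by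
            rw [show b' - 1 + 1 = b' by omega]; exact hup)
          exact hstep'
        have h2 : b' - (d + 1) + 1 = b' - d := by omega
        rw [h2] at h1
        exact h1.trans (ih (by omega))
    have := hmono (b' - b) (by omega)
    rw [show b' - (b' - b) = b by omega] at this
    exact (min_le_left _ _).trans this
  · -- the step into `b'` is downward, hence so is every step above it: `f` is antitone on `[b', K)`
    have hanti : ∀ d, b' + d < K → f (b' + d) ≤ f b' := by
      intro d
      induction d with
      | zero => intro _; simp
      | succ d ih =>
        intro hd
        have h1 : f (b' + d + 1) ≤ f (b' + d) := by
          by_contra hcon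
          push Not at hcon
          have := hstep (b' - 1) (b' + d) (by omega) (by omega) hcon.le
          rw [show b' - 1 + 1 = b' by omega] at this
          exact absurd this (not_le.2 hdown)
        have h2 : b' + (d + 1) = b' + d + 1 := by omega
        rw [h2]
        exact h1.trans (ih (by omega))
    have := hanti (b'' - b') (by omega)
    rw [show b' + (b'' - b') = b'' by omega] at this
    exact (min_le_right _ _).trans this

/-- The interval property of the excesses from the quasi-concavity of `ψ`. -/
theorem interval_of_quasiconcave (hr : ∀ c, c < m → 0 < r (ℓ - c + 1))
    (hqc : ∀ b b' b'', b ≤ b' → b' ≤ b'' → b'' < m → min (psi ℓ ρ r q b) (psi ℓ ρ r q b'') ≤ psi ℓ ρ r q b') :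
    ∀ b b' b'', b ≤ b' → b' ≤ b'' → b'' < m → 0 ≤ en m ℓ ρ θ r q b → 0 ≤ en m ℓ ρ θ r q b'' →
      0 ≤ en m ℓ ρ θ r q b' := by
  intro b b' b'' hbb' hb'b'' hb'' hb hb''pos
  rw [en_nonneg_iff_psi b (by omega) (hr b (by omega))] at hb
  rw [en_nonneg_iff_psi b'' (by omega) (hr b'' hb'')] at hb''pos
  rw [en_nonneg_iff_psi b' (by omega) (hr b' (by omega))]
  have := hqc b b' b'' hbb' hb'b'' hb''
  exact (le_min hb hb''pos).trans this

/-- The layer ratio `u b = r (ℓ−b) / r (ℓ−b+1)` (rows per free column of the fibre over layer `b`). -/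
def uq (ℓ : ℕ) (r : ℕ → ℚ) (b : ℕ) : ℚ := r (ℓ - b) / r (ℓ - b + 1)

/-- The layer ratio `v b = q (ℓ−b) / r (ℓ−b+1)` (the other members' columns per free column of the fibre over layer
`b`). -/
def vq (ℓ : ℕ) (r q : ℕ → ℚ) (b : ℕ) : ℚ := q (ℓ - b) / r (ℓ - b + 1)

/-- `ψ b = ρ·u b − v b`. -/
theorem psi_eq (b : ℕ) : psi ℓ ρ r q b = ρ * uq ℓ r b - vq ℓ r q b := by
  unfold psi uq vq
  ring

/-- **THE STEPS OF `ψ` FROM THE SLOPES OF THE CHAIN.** If `u` strictly decreases along the layers and the slopes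
`(v c − v (c+1)) / (u c − u (c+1))` of the chain `b ↦ (u b, v b)` decrease along the layers (the chain is convex), then
the upward steps of `ψ = ρ·u − v` are downward closed: `ψ` rises then falls. -/
theorem steps_of_slopes (hu : ∀ c, c + 1 < m → uq ℓ r (c + 1) < uq ℓ r c)
    (hσ : ∀ c c', c ≤ c' → c' + 1 < m →
      (vq ℓ r q c' - vq ℓ r q (c' + 1)) * (uq ℓ r c - uq ℓ r (c + 1))
        ≤ (vq ℓ r q c - vq ℓ r q (c + 1)) * (uq ℓ r c' - uq ℓ r (c' + 1))) :
    ∀ c c', c ≤ c' → c' + 1 < m → psi ℓ ρ r q c' ≤ psi ℓ ρ r q (c' + 1) →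
      psi ℓ ρ r q c ≤ psi ℓ ρ r q (c + 1) := by
  intro c c' hcc' hc' hstep
  rw [psi_eq, psi_eq] at hstep ⊢
  have huc := hu c (by omega)
  have huc' := hu c' hc'
  have hdc : 0 < uq ℓ r c - uq ℓ r (c + 1) := by linarith
  have hdc' : 0 < uq ℓ r c' - uq ℓ r (c' + 1) := by linarith
  -- the step `c'` upward: `ρ·(u c' − u (c'+1)) ≤ v c' − v (c'+1)`
  have h1 : ρ * (uq ℓ r c' - uq ℓ r (c' + 1)) ≤ vq ℓ r q c' - vq ℓ r q (c' + 1) := by linarith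
  have h2 := hσ c c' hcc' hc'
  have h3 : ρ * (uq ℓ r c' - uq ℓ r (c' + 1)) * (uq ℓ r c - uq ℓ r (c + 1))
      ≤ (vq ℓ r q c - vq ℓ r q (c + 1)) * (uq ℓ r c' - uq ℓ r (c' + 1)) :=
    (mul_le_mul_of_nonneg_right h1 hdc.le).trans h2
  have h4 : ρ * (uq ℓ r c - uq ℓ r (c + 1)) ≤ vq ℓ r q c - vq ℓ r q (c + 1) := by
    have h5 : (ρ * (uq ℓ r c - uq ℓ r (c + 1))) * (uq ℓ r c' - uq ℓ r (c' + 1))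
        ≤ (vq ℓ r q c - vq ℓ r q (c + 1)) * (uq ℓ r c' - uq ℓ r (c' + 1)) := by
      linarith [h3]
    exact le_of_mul_le_mul_right h5 hdc'
  linarith

/-- **THE FIRST FAMILY AT A MULTI-MEMBER NODE.** If every fibre has free columns, the chain `b ↦ (u b, v b)` of the
other members' layer ratios is convex (`hu`, `hσ`), the excess of layer `0` is nonnegative (the fibre-0 density
condition) and the totals `Hn m = NC` are nonnegative, then `0 ≤ Hn a` for every `a ≤ m`. -/
theorem first_family (hr : ∀ c, c < m → 0 < r (ℓ - c + 1))
    (hu : ∀ c, c + 1 < m → uq ℓ r (c + 1) < uq ℓ r c)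
    (hσ : ∀ c c', c ≤ c' → c' + 1 < m →
      (vq ℓ r q c' - vq ℓ r q (c' + 1)) * (uq ℓ r c - uq ℓ r (c + 1))
        ≤ (vq ℓ r q c - vq ℓ r q (c + 1)) * (uq ℓ r c' - uq ℓ r (c' + 1)))
    (h0 : 0 ≤ en m ℓ ρ θ r q 0) (htot : Hn m ℓ ρ θ r q m = NC) (hNC : 0 ≤ NC) :
    ∀ a, a ≤ m → 0 ≤ Hn m ℓ ρ θ r q a := by
  apply first_family_of_interval _ h0 htot hNC
  apply interval_of_quasiconcave hr
  intro b b' b'' hbb' hb'b'' hb''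
  exact quasiconcave_of_steps (psi ℓ ρ r q) m (steps_of_slopes hu hσ) b b' b'' hbb' hb'b'' hb''

end

end PercRepro.PuncturedLYM.Split.NodeArith
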